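import Summits.ResolutionOfSingularities.ResolutionOfSingularities.Theorems.SharpStrataSepExcModelsModelValuation
import Summits.ResolutionOfSingularities.ResolutionOfSingularities.Theorems.SharpStrataSepExcModelsSharpRelation
import Literature.FieldTheory.Separability.FormallySmoothSeparablyGenerated
import HarnessLib

/-!
# The sharpness certificate: a sharp relation forbids separable regular birational local models

Line `birth` of crux `SharpStrata.SepExcModels` (stmt-ResolutionOfSingularities-16828,
`Cruxes/SepExcModels/Lines/birth.lean`), lead c1, tool stub (N1') `stub_not_model_of_sharpRelation`,
PROVED.

Setting: `A` a finitely generated algebra over a field `k` with fraction field `K` of characteristic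
`p ≥ 3`, `R = A_P` realised inside `K`, and elements `z, x, y, t, e₁, e₂ ∈ R` with the SHARP
RELATION `t^p = z x^p + z² y^p + e₁ x^p + e₂ y^p`, where `x, y ≠ 0` (in `K`), `x, y, e₁, e₂ ∈ 𝔪_R`,
and the residue of `z` is NOT a `p`-th power in `κ(R) = R/𝔪_R`. Conclusion: the third disjunct of
`SepExcAt` FAILS at `R` — there is no `B = R[s] ⊆ K` (`s` finite) with a prime `𝔮` over `𝔪_R` such
that `B_𝔮` is regular and `(B/𝔮)[1/g]` is smooth over `κ(R)` for some `g ∉ 𝔮`.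

## Proof

* By the converse of the valuative criterion (T6,
  `ModelValuation.stub_sepAbhyankarPlace_of_model`) such a model yields a valuation ring `O` of `K`
  receiving `R` by `φ` over `K`, dominating it, with `κ(O) / κ(R)` formally smooth.
* Domination gives `v(x), v(y), v(e₁), v(e₂) < 1` and `z ∈ O`, so by the residue computation (N1,
  `SharpRelation.stub_residue_pthPower_of_sharpRelation`) the residue `z̄` of `z` is a `p`-th power
  `ū^p` in `κ(O)`.
* MacLane: `ū ∉ κ(R)` (its `p`-th power `z̄` is not a `p`-th power of an element of `κ(R)`), so
  `{1, ū}` is `κ(R)`-linearly independent in `κ(O)`, while `{1^p, ū^p} = {1, z̄}` is `κ(R)`-linearly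
  dependent; this violates MacLane's condition, which holds for the formally smooth extension
  `κ(O) / κ(R)` (`Literature.FieldTheory.Separability.linearIndepOn_pow_of_formallySmooth`,
  Matsumura 26.9).

Instance (recorded in `Cruxes/SepExcModels/Q-positive-sharp-3fold.md`): the normal threefold
`t^p = z x^p + z² y^p + x^{p+1} + y^{p+1}` over a perfect field is sharp along the `z`-axis.

## Sources

* A. Benito, O. Piltant, A. J. Reguera, *Small irreducible components of arc spaces in positive
  characteristic*, J. Pure Appl. Algebra 226 (2022) 107113, Question 6.6, Example 6.3 (method).
  [BenitoPiltantReguera2022]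
* H. Matsumura, *Commutative Ring Theory*, Thm. 26.9 (formal smoothness and MacLane's criterion).
  [Matsumura1987]
-/

noncomputable section

-- single-problem summit: the doubled namespace component `ResolutionOfSingularities` is forced
set_option linter.dupNamespace false

open Literature.AlgebraicGeometry.Resolution IsLocalRing
open Literature.FieldTheory.Separability

namespace Summit.ResolutionOfSingularities.ResolutionOfSingularities.Theorems.SepExcModels.SharpCertificate

/-! ## MacLane's obstruction: a new `p`-th root of an old non-`p`-th power -/

/-- **MacLane's obstruction.** Let `ψ : κ → E` be a homomorphism of fields of characteristic `p`
making `E` a formally smooth `κ`-algebra. If `c ∈ E` satisfies `c^p = ψ ζ` for some `ζ ∈ κ`, then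
`ζ` is already a `p`-th power in `κ`: otherwise `{1, c}` is `κ`-linearly independent with
`κ`-linearly dependent `p`-th powers `{1, ψ ζ}`, against MacLane's condition
(`linearIndepOn_pow_of_formallySmooth`). [cite: Matsumura1987, Thm. 26.9] -/
theorem exists_pow_eq_of_pow_eq_algebraMap {κ E : Type*} [Field κ] [Field E] [Algebra κ E]
    (p : ℕ) [Fact p.Prime] [CharP κ p] [Algebra.FormallySmooth κ E] (ζ : κ) (c : E)
    (hc : c ^ p = algebraMap κ E ζ) : ∃ a : κ, a ^ p = ζ := by
  classical
  have hinj : Function.Injective (algebraMap κ E) := (algebraMap κ E).injective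
  by_contra hno
  push Not at hno
  -- `c ≠ 1`
  have h1c : (1 : E) ≠ c := fun h => by
    refine hno 1 (hinj ?_)
    rw [map_pow, map_one, one_pow, ← hc, ← h, one_pow]
  -- `{1, c}` is `κ`-linearly independent
  have hind : LinearIndepOn κ _root_.id (({1, c} : Finset E) : Set E) := by
    refine linearIndepOn_finset_iff.mpr fun f hf => ?_
    rw [Finset.sum_pair h1c] at hf
    simp only [_root_.id, Algebra.smul_def, mul_one] at hf
    by_cases hfc : f c = 0
    · rw [hfc, map_zero, zero_mul, add_zero, map_eq_zero_iff _ hinj] at hf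
      intro i hi
      rcases Finset.mem_insert.mp hi with rfl | hi
      · exact hf
      · rw [Finset.mem_singleton.mp hi]; exact hfc
    · exfalso
      have hψc : algebraMap κ E (f c) ≠ 0 := (map_ne_zero_iff _ hinj).mpr hfc
      have hceq : c = algebraMap κ E (-(f 1) / f c) := by
        rw [map_div₀, map_neg, eq_div_iff hψc]
        linear_combination hf
      refine hno (-(f 1) / f c) (hinj ?_)
      rw [map_pow, ← hceq, hc]
  -- but `{1, c^p} = {1, ψ ζ}` is `κ`-linearly dependent
  have hpow := linearIndepOn_pow_of_formallySmooth p ({1, c} : Finset E) hind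
  have hcmem : c ∈ ({1, c} : Finset E) := Finset.mem_insert_of_mem (Finset.mem_singleton_self c)
  have h := linearIndepOn_finset_iff.mp hpow (fun w => if w = 1 then ζ else -1) ?_ c hcmem
  · simp only [if_neg (Ne.symm h1c), neg_eq_zero, one_ne_zero] at h
  · rw [Finset.sum_pair h1c]
    show (if (1 : E) = 1 then ζ else -1) • (1 : E) ^ p + (if c = 1 then ζ else -1) • c ^ p = 0
    rw [if_pos rfl, if_neg (Ne.symm h1c), one_pow, hc, Algebra.smul_def, Algebra.smul_def, map_neg,
      map_one]
    ring

/-! ## The registered stub -/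

/-- **STUB (N1') of line `birth` of crux `SepExcModels`, PROVED: the SHARPNESS CERTIFICATE.** At
`R = A_P` (finitely generated `A` over a field `k`, inside `K = Frac A` of characteristic `p ≥ 3`):
if `R` contains `z, x, y, t, e₁, e₂` with `t^p = z x^p + z² y^p + e₁ x^p + e₂ y^p`, `x, y ≠ 0`,
`x, y, e₁, e₂ ∈ 𝔪_R`, and the residue of `z` is NOT a `p`-th power in `κ(R)`, then the third
disjunct of `SepExcAt` FAILS at `R`: by T6 (`ModelValuation.stub_sepAbhyankarPlace_of_model`) a
model would give a valuation ring `O` of `K` dominating `R` with `κ(O)/κ(R)` formally smooth, by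
N1 (`SharpRelation.stub_residue_pthPower_of_sharpRelation`) `z̄` becomes a `p`-th power `ū^p` in
`κ(O)`, and then `{1, ū}` is `κ(R)`-independent with `κ(R)`-dependent `p`-th powers `{1, z̄}` —
MacLane's condition, which formal smoothness implies (`linearIndepOn_pow_of_formallySmooth`), is
violated (`exists_pow_eq_of_pow_eq_algebraMap`).
[cite: BenitoPiltantReguera2022, Ex. 6.3 (method); Matsumura1987, Thm. 26.9] -/
theorem stub_not_model_of_sharpRelation {k A K R : Type} [Field k]
    [CommRing A] [Algebra k A] [Algebra.FiniteType k A] [Field K] [Algebra k K] [Algebra A K]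
    [IsScalarTower k A K] [IsFractionRing A K] [CommRing R] [IsLocalRing R] [Algebra A R]
    [Algebra R K] [IsScalarTower A R K] (P : Ideal A) [P.IsPrime] [IsLocalization.AtPrime R P]
    (p : ℕ) [Fact p.Prime] [CharP K p] (hp : 3 ≤ p) (z x y t e₁ e₂ : R)
    (hrel : t ^ p = z * x ^ p + z ^ 2 * y ^ p + e₁ * x ^ p + e₂ * y ^ p)
    (hx0 : algebraMap R K x ≠ 0) (hy0 : algebraMap R K y ≠ 0)
    (hx : x ∈ IsLocalRing.maximalIdeal R) (hy : y ∈ IsLocalRing.maximalIdeal R)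
    (he₁ : e₁ ∈ IsLocalRing.maximalIdeal R) (he₂ : e₂ ∈ IsLocalRing.maximalIdeal R)
    (hz : ∀ r : R, IsLocalRing.residue R r ^ p ≠ IsLocalRing.residue R z) :
    ¬ ∃ (s : Finset K) (𝔮 : Ideal (Algebra.adjoin R (s : Set K))) (_ : 𝔮.IsPrime)
      (hle : IsLocalRing.maximalIdeal R ≤ 𝔮.comap (algebraMap R (Algebra.adjoin R (s : Set K)))),
      IsRegularLocalRing (Localization.AtPrime 𝔮) ∧
        ∃ g : Algebra.adjoin R (s : Set K), g ∉ 𝔮 ∧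
          @Algebra.Smooth (R ⧸ IsLocalRing.maximalIdeal R) _
            (Localization.Away (Ideal.Quotient.mk 𝔮 g)) _
            ((algebraMap _ (Localization.Away (Ideal.Quotient.mk 𝔮 g))).comp
              (Ideal.quotientMap 𝔮 (algebraMap R (Algebra.adjoin R (s : Set K))) hle)).toAlgebra := by
  classical
  rintro ⟨s, 𝔮, h𝔮, hle, hreg, g, hg, hsm⟩
  obtain ⟨O, φ, hφ, hdom, -, hfs⟩ :=
    ModelValuation.stub_sepAbhyankarPlace_of_model (k := k) P s 𝔮 hle hreg g hg hsm
  -- (0) `R ⊆ K`, so `R` and `κ(R)` have characteristic `p`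
  haveI : IsDomain A :=
    Function.Injective.isDomain (algebraMap A K) (IsFractionRing.injective A K)
  haveI : IsFractionRing R K :=
    IsFractionRing.isFractionRing_of_isDomain_of_isLocalization P.primeCompl R K
  haveI : CharP R p := RingHom.charP (algebraMap R K) (IsFractionRing.injective R K) p
  haveI : CharP (ResidueField R) p := by
    refine (CharP.charP_iff_prime_eq_zero Fact.out).2 ?_
    rw [← map_natCast (IsLocalRing.residue R), CharP.cast_eq_zero, map_zero]
  -- (1) valuation facts from domination
  have hval : ∀ r ∈ maximalIdeal R, O.valuation (algebraMap R K r) < 1 := fun r hr => by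
    rw [← hφ]
    exact (ValuationSubring.valuation_lt_one_iff O (φ r)).mp (hdom hr)
  have hzO : algebraMap R K z ∈ O := by
    rw [← hφ]
    exact (φ z).2
  -- (2) the relation in `K`; by N1, `z̄` is a `p`-th power in `κ(O)`
  have hrelK : algebraMap R K t ^ p = algebraMap R K z * algebraMap R K x ^ p +
      algebraMap R K z ^ 2 * algebraMap R K y ^ p + algebraMap R K e₁ * algebraMap R K x ^ p +
      algebraMap R K e₂ * algebraMap R K y ^ p := by
    have h := congrArg (algebraMap R K) hrel
    simpa only [map_pow, map_mul, map_add] using h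
  obtain ⟨u, hu⟩ := SharpRelation.stub_residue_pthPower_of_sharpRelation p hp _ _ _ _ _ _ hrelK
    hx0 hy0 O hzO (hval x hx) (hval y hy) (hval e₁ he₁) (hval e₂ he₂)
  have hφz : (⟨algebraMap R K z, hzO⟩ : O) = φ z := Subtype.ext (hφ z).symm
  rw [hφz] at hu
  -- (3) MacLane's obstruction for the formally smooth `κ(R) → κ(O)`
  let ψ : ResidueField R →+* ResidueField O := Ideal.quotientMap (maximalIdeal O) φ hdom
  letI algRO : Algebra (ResidueField R) (ResidueField O) := ψ.toAlgebra
  haveI : Algebra.FormallySmooth (ResidueField R) (ResidueField O) := hfs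
  have hψz : algebraMap (ResidueField R) (ResidueField O) (residue R z) = residue O (φ z) := rfl
  obtain ⟨a, ha⟩ := exists_pow_eq_of_pow_eq_algebraMap (κ := ResidueField R) (E := ResidueField O)
    p (residue R z) (residue O u) (by rw [hψz, hu])
  obtain ⟨r, rfl⟩ := IsLocalRing.residue_surjective a
  exact hz r ha

end Summit.ResolutionOfSingularities.ResolutionOfSingularities.Theorems.SepExcModels.SharpCertificate

end
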